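import Mathlib.Data.Sym.Card
import Mathlib.Data.Fintype.Vector
import Mathlib.Data.Nat.Choose.Bounds
import Summits.ValiantsHypothesis.ValiantsHypothesis.Theses.KPlusLogSqLaw
import Summits.ValiantsHypothesis.ValiantsHypothesis.Theorems.MatrixDescartes.Negative.MatrixDescartesFalseOfTropicalMonster
import Summits.ValiantsHypothesis.ValiantsHypothesis.Theorems.LacunarySymmetroidMatrixDescartesCensusKLawBridge
import Summits.ValiantsHypothesis.ValiantsHypothesis.Theorems.LacunarySymmetroidMatrixDescartesCensusFrame
import Summits.ValiantsHypothesis.ValiantsHypothesis.Theorems.LacunarySymmetroidMatrixDescartesCensusClassicalRows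
import Summits.ValiantsHypothesis.ValiantsHypothesis.Theorems.LacunarySymmetroidAssembly
import Summits.ValiantsHypothesis.ValiantsHypothesis.Theorems.LacunarySymmetroidPencilTransfer
import Summits.ValiantsHypothesis.ValiantsHypothesis.Theorems.LacunarySymmetroidThetaWitness

set_option linter.dupNamespace false
set_option autoImplicit false

/-! ## Route «KPlusLogSqLaw» (route-ValiantsHypothesis-KPlusLogSqLaw): birth workfile over the BORN route file. -/

namespace Summit.ValiantsHypothesis.ValiantsHypothesis.Theses.KPlusLogSqLaw

/-- local name for the tropical census row (δ-equal to helper part 1's `TropicalCensus.TropRootLawAt`, p406287). -/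
def TropRow (m K B : ℕ) : Prop :=
  ∀ (d : Fin K → ℕ) (v ε : Fin m → Fin m → Fin K → ℤ) (n : ℕ) (θ : Fin (n + 1) → ℤ)
    (p : Fin (n + 1) → Equiv.Perm (Fin m) × (Fin m → Fin K)),
    (∀ i j l, (ε i j l).natAbs ≤ 1) → StrictMono θ →
    (∀ k, Summit.ValiantsHypothesis.ValiantsHypothesis.Theorems.MatrixDescartes.Negative.IsDominant d v ε (θ k) (p k)) →
    (∀ k : Fin n, Summit.ValiantsHypothesis.ValiantsHypothesis.Theorems.MatrixDescartes.Negative.termSign ε (p k.castSucc) *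
      Summit.ValiantsHypothesis.ValiantsHypothesis.Theorems.MatrixDescartes.Negative.termSign ε (p k.succ) < 0) → n ≤ B

theorem tropicalB_iff : TropicalB ↔ ∃ C : ℕ, ∀ m K : ℕ, TropRow m K (2 ^ (C * (K + Nat.log 2 m ^ 2))) := Iff.rfl

theorem lifting_iff : Lifting ↔ ∃ C : ℕ, ∀ m K n : ℕ, TropRow m K n →
    Summit.ValiantsHypothesis.ValiantsHypothesis.Theorems.LacunarySymmetroidMatrixDescartes.RealRootLawAt m K (2 ^ (C * K) * (n + 1)) :=
  Iff.rfl

end Summit.ValiantsHypothesis.ValiantsHypothesis.Theses.KPlusLogSqLaw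

/-! ## BC3 birth skeleton of crux `Lifting` (inline variant) + BC5 rungs. -/

namespace Summit.ValiantsHypothesis.ValiantsHypothesis.Theses.KPlusLogSqLaw

open Summit.ValiantsHypothesis.ValiantsHypothesis.Theorems.MatrixDescartes.Negative
open Summit.ValiantsHypothesis.ValiantsHypothesis.Theorems.LacunarySymmetroidMatrixDescartes
open scoped BigOperators
open Finset

/-- stub (LIFT, thin regime `K ≤ log₂² m`). -/
theorem stub_liftThin :
    ∃ C : ℕ, ∀ m K n : ℕ, K ≤ Nat.log 2 m ^ 2 → TropRow m K n → RealRootLawAt m K (2 ^ (C * K) * (n + 1)) := by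
  sorry

/-- stub (LIFT, fat regime `log₂² m ≤ K`); at `m ≤ K` it is the Descartes-vacuous `Lifting_rung_fatEnd`. -/
theorem stub_liftFat :
    ∃ C : ℕ, ∀ m K n : ℕ, Nat.log 2 m ^ 2 ≤ K → TropRow m K n → RealRootLawAt m K (2 ^ (C * K) * (n + 1)) := by
  sorry

/-- PLAN-ONLY BC5 rung (lead R1299): LIFT at `K = 3` for all `m` — from a PROVED counting-tight tropical family
`T(m,3) ≥ C(m+2,2) − 1` (the circulant `K3_typeA` designs, replayed for `m ≤ 32` in tools/conjb2/designs.py, to be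
formalised) and Descartes `Census.realRootLawAt_descartes` (`2 C(m+2,2) − 1 ≤ 2^9 C(m+2,2)`); technique: explicit design +
`Census.realRootLawAt_descartes` + `Census.realRootLawAt_mono`. Outside S's decided strip (the real row (m,3) is open for m ≥ 3). -/
theorem stub_liftRungThree : ∀ m n : ℕ, TropRow m 3 n → RealRootLawAt m 3 (2 ^ (3 * 3) * (n + 1)) := by
  sorry

/-- BC3 composition for `Lifting` (concluding the UNFOLDED crux, so that `Lifting_skeleton` below is the unique theorem concluding
`Lifting` by name — `#h21_check_skeleton` takes the first such theorem): the two regimes glue with `C = C₁ + C₂`. -/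
theorem Lifting_of
    (h₁ : ∃ C : ℕ, ∀ m K n : ℕ, K ≤ Nat.log 2 m ^ 2 → TropRow m K n → RealRootLawAt m K (2 ^ (C * K) * (n + 1)))
    (h₂ : ∃ C : ℕ, ∀ m K n : ℕ, Nat.log 2 m ^ 2 ≤ K → TropRow m K n → RealRootLawAt m K (2 ^ (C * K) * (n + 1))) :
    ∃ C : ℕ, ∀ m K n : ℕ, TropRow m K n → RealRootLawAt m K (2 ^ (C * K) * (n + 1)) := by
  obtain ⟨C₁, h₁⟩ := h₁
  obtain ⟨C₂, h₂⟩ := h₂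
  refine ⟨C₁ + C₂, fun m K n hT => ?_⟩
  rcases le_total K (Nat.log 2 m ^ 2) with hK | hK
  · refine Census.realRootLawAt_mono (Nat.mul_le_mul_right _ (Nat.pow_le_pow_right (by norm_num) ?_)) (h₁ m K n hK hT)
    nlinarith [Nat.zero_le (C₂ * K)]
  · refine Census.realRootLawAt_mono (Nat.mul_le_mul_right _ (Nat.pow_le_pow_right (by norm_num) ?_)) (h₂ m K n hK hT)
    nlinarith [Nat.zero_le (C₁ * K)]

/-- SKELETON THEOREM (hypothesis-free form required by `#h21_check_skeleton`: stubs enter BY NAME): the crux from the two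
declared regime stubs via `Lifting_of` (the plan-only BC5 rung `stub_liftRungThree` is a registered stub but not a hypothesis). -/
theorem Lifting_skeleton : Lifting := Lifting_of stub_liftThin stub_liftFat

/-! ### BC5 rung 1 (theorem; toy, `K = 2`, inside S's decided strip): an explicit dominance design with `m` alternations
forces `m ≤ n`, and the tree row `Census.realRootLawAt_two` gives `RealRootLawAt m 2 (2m+1)`, `2m+1 ≤ 4(n+1)`. -/

namespace DiagTwo

variable (m : ℕ)

/-- exponents `d = (0, 1)`. -/
def dd : Fin 2 → ℕ := fun l => l.val

/-- signs: diagonal entries carry class `0` with `+1` and class `1` with `−1`; off-diagonal entries absent. -/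
def ee : Fin m → Fin m → Fin 2 → ℤ := fun a b l => if a = b then (if l = 0 then 1 else -1) else 0

/-- valuations: class `1` at column `b` has valuation `2b + 1`, class `0` valuation `0`. -/
def vv : Fin m → Fin m → Fin 2 → ℤ := fun _ b l => if l = 1 then 2 * (b : ℤ) + 1 else 0

/-- the chain of slopes `θ_k = 2k`. -/
def th : Fin (m + 1) → ℤ := fun k => 2 * (k : ℤ)

/-- the chain of terms: identity permutation, class profile `λ_k i = [i < k]`. -/
def lam (k : Fin (m + 1)) : Fin m → Fin 2 := fun i => if (i : ℕ) < (k : ℕ) then 1 else 0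

def pp (k : Fin (m + 1)) : Equiv.Perm (Fin m) × (Fin m → Fin 2) := (1, lam m k)

theorem ee_natAbs (a b : Fin m) (l : Fin 2) : (ee m a b l).natAbs ≤ 1 := by
  unfold ee; split_ifs <;> simp

theorem th_strictMono : StrictMono (th m) := by
  intro a b hab
  unfold th
  have : (a : ℤ) < (b : ℤ) := by exact_mod_cast hab
  linarith

/-- a present term uses the identity permutation. -/
theorem perm_eq_one_of_termSign_ne_zero (q : Equiv.Perm (Fin m) × (Fin m → Fin 2))
    (hq : termSign (ee m) q ≠ 0) : q.1 = 1 := by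
  unfold termSign at hq
  have hprod : ∏ i, ee m (q.1 i) i (q.2 i) ≠ 0 := fun h => hq (by rw [h, mul_zero])
  rw [Finset.prod_ne_zero_iff] at hprod
  refine Equiv.ext fun i => ?_
  have hi := hprod i (Finset.mem_univ i)
  unfold ee at hi
  by_contra hne
  rw [Equiv.Perm.coe_one, id_eq] at hne
  exact hi (if_neg hne)

/-- tropical weight of an identity term: `∑ᵢ [λ i = 1]·(θ − 2i − 1)`. -/
theorem tropWeight_one (θ : ℤ) (la : Fin m → Fin 2) :
    tropWeight (dd) (vv m) θ (1, la) = ∑ i : Fin m, (if la i = 1 then θ - 2 * (i : ℤ) - 1 else 0) := by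
  unfold tropWeight dd vv
  rw [Finset.mul_sum, ← Finset.sum_sub_distrib]
  refine Finset.sum_congr rfl fun i _ => ?_
  have h2 : la i = 0 ∨ la i = 1 := by
    rcases la i with ⟨v, hv⟩
    rcases v with _ | v
    · left; rfl
    · right; ext; simp; omega
  rcases h2 with h | h
  · simp [h]
  · simp [h, sub_sub]

/-- one summand of the weight is maximised by the chain profile … -/
theorem summand_le (k : Fin (m + 1)) (i : Fin m) (l : Fin 2) :
    (if l = 1 then th m k - 2 * (i : ℤ) - 1 else 0) ≤
      (if lam m k i = 1 then th m k - 2 * (i : ℤ) - 1 else 0) := by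
  unfold lam th
  have h2 : l = 0 ∨ l = 1 := by
    rcases l with ⟨v, hv⟩
    rcases v with _ | v
    · left; rfl
    · right; ext; simp; omega
  by_cases hik : (i : ℕ) < (k : ℕ)
  · rw [if_pos hik]
    rcases h2 with rfl | rfl
    · rw [if_neg (by decide), if_pos rfl]
      have : (i : ℤ) + 1 ≤ (k : ℕ) := by exact_mod_cast hik
      linarith
    · exact le_rfl
  · rw [if_neg hik]
    rcases h2 with rfl | rfl
    · exact le_rfl
    · rw [if_pos rfl, if_neg (by decide)]
      have : ((k : ℕ) : ℤ) ≤ (i : ℕ) := by exact_mod_cast Nat.le_of_not_lt hik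
      linarith

/-- … and strictly so unless the class agrees with the profile. -/
theorem summand_lt (k : Fin (m + 1)) (i : Fin m) (l : Fin 2) (hl : l ≠ lam m k i) :
    (if l = 1 then th m k - 2 * (i : ℤ) - 1 else 0) <
      (if lam m k i = 1 then th m k - 2 * (i : ℤ) - 1 else 0) := by
  revert hl
  unfold lam th
  intro hl
  have h2 : l = 0 ∨ l = 1 := by
    rcases l with ⟨v, hv⟩
    rcases v with _ | v
    · left; rfl
    · right; ext; simp; omega
  by_cases hik : (i : ℕ) < (k : ℕ)
  · rw [if_pos hik] at hl ⊢
    rcases h2 with rfl | rfl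
    · rw [if_neg (by decide), if_pos rfl]
      have : (i : ℤ) + 1 ≤ (k : ℕ) := by exact_mod_cast hik
      linarith
    · exact absurd rfl hl
  · rw [if_neg hik] at hl ⊢
    rcases h2 with rfl | rfl
    · exact absurd rfl hl
    · rw [if_pos rfl, if_neg (by decide)]
      have : ((k : ℕ) : ℤ) ≤ (i : ℕ) := by exact_mod_cast Nat.le_of_not_lt hik
      linarith

/-- the chain term `λ_k` is the unique optimum at `θ_k = 2k`. -/
theorem isDominant (k : Fin (m + 1)) : IsDominant dd (vv m) (ee m) (th m k) (pp m k) := by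
  refine ⟨?_, ?_⟩
  · -- present
    unfold termSign pp
    simp only [Equiv.Perm.sign_one, Units.val_one, one_mul, Equiv.Perm.coe_one, id_eq]
    rw [Finset.prod_ne_zero_iff]
    intro i _
    unfold ee lam
    simp only [if_true]
    split_ifs <;> simp
  · intro q hq hqs
    have hq1 := perm_eq_one_of_termSign_ne_zero m q hqs
    have hq' : q = (1, q.2) := Prod.ext hq1 rfl
    have hne : q.2 ≠ lam m k := by
      intro h; apply hq; rw [hq', h]; rfl
    rw [hq', tropWeight_one]
    unfold pp
    rw [tropWeight_one]
    -- pointwise domination with one strict index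
    obtain ⟨i0, hi0⟩ : ∃ i, q.2 i ≠ lam m k i := by
      by_contra h; push Not at h; exact hne (funext h)
    exact Finset.sum_lt_sum (fun i _ => summand_le m k i (q.2 i)) ⟨i0, Finset.mem_univ _, summand_lt m k i0 _ hi0⟩

/-- the sign of the chain term `λ_k` is `(−1)^k`. -/
theorem termSign_pp (k : Fin (m + 1)) : termSign (ee m) (pp m k) = (-1) ^ (k : ℕ) := by
  unfold termSign pp
  simp only [Equiv.Perm.sign_one, Units.val_one, one_mul, Equiv.Perm.coe_one, id_eq]
  have h1 : ∀ i : Fin m, ee m i i (lam m k i) = if (i : ℕ) < (k : ℕ) then -1 else 1 := by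
    intro i; unfold ee lam; by_cases h : (i : ℕ) < (k : ℕ) <;> simp [h]
  simp_rw [h1]
  rw [Fin.prod_univ_eq_prod_range (fun i => if i < (k : ℕ) then (-1 : ℤ) else 1) m]
  have hk : (k : ℕ) ≤ m := Nat.lt_succ_iff.mp k.isLt
  rw [← Finset.prod_range_mul_prod_Ico _ hk]
  rw [Finset.prod_congr rfl (fun i hi => if_pos (Finset.mem_range.mp hi)),
    Finset.prod_congr rfl (fun i hi => if_neg (not_lt.mpr (Finset.mem_Ico.mp hi).1))]
  simp

theorem alternates (k : Fin m) :
    termSign (ee m) (pp m k.castSucc) * termSign (ee m) (pp m k.succ) < 0 := by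
  rw [termSign_pp, termSign_pp, Fin.val_castSucc, Fin.val_succ, ← pow_add]
  have : (-1 : ℤ) ^ ((k : ℕ) + ((k : ℕ) + 1)) = -1 := by
    rw [show (k : ℕ) + ((k : ℕ) + 1) = 2 * (k : ℕ) + 1 by ring, pow_succ, pow_mul]; simp
  rw [this]; norm_num

end DiagTwo

/-- **The two-class tropical row is at least `m`:** `TropRow m 2 B → m ≤ B`. -/
theorem le_of_tropRow_two_classes {m B : ℕ} (h : TropRow m 2 B) : m ≤ B :=
  h DiagTwo.dd (DiagTwo.vv m) (DiagTwo.ee m) m (DiagTwo.th m) (DiagTwo.pp m) (DiagTwo.ee_natAbs m)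
    (DiagTwo.th_strictMono m) (DiagTwo.isDominant m) (DiagTwo.alternates m)

/-- **LIFT, rung `K = 2` (all `m`, `C = 1`):** the tropical row bound controls the real row. -/
theorem lifting_rung_two (m B : ℕ) (h : TropRow m 2 B) :
    RealRootLawAt m 2 (2 ^ (1 * 2) * (B + 1)) := by
  have hm := le_of_tropRow_two_classes h
  refine Census.realRootLawAt_mono ?_ (Census.realRootLawAt_two m)
  have : 2 ^ (1 * 2) * (B + 1) = 4 * (B + 1) := by norm_num
  omega


/-- **BC5 rung of `Lifting` at `K = 2`** (theorem): `TropRow m 2 n → RealRootLawAt m 2 (4(n+1))` for all `m`. -/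
theorem Lifting_rung_two (m n : ℕ) (h : TropRow m 2 n) : RealRootLawAt m 2 (2 ^ (1 * 2) * (n + 1)) :=
  lifting_rung_two m n h

/-! ### BC5 rung 2 (theorem; Descartes-vacuous fat end `m ≤ K`, C = 3, no tropical input). -/

theorem realRootLawAt_zero (m B : ℕ) : RealRootLawAt m 0 B := by
  intro d S _
  have h0 : (∑ l : Fin 0, ((Polynomial.X : Polynomial ℝ) ^ d l) • (S l).map Polynomial.C) = 0 := by simp
  rw [h0]
  rcases Nat.eq_zero_or_pos m with hm | hm
  · subst hm
    simp [Matrix.det_isEmpty]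
  · haveI : Nonempty (Fin m) := ⟨⟨0, hm⟩⟩
    simp [Matrix.det_zero]

/-- the real row at the fat end is below `2^(2K)` outright (Descartes). -/
theorem realRootLawAt_fatEnd {m K : ℕ} (hmK : m ≤ K) : RealRootLawAt m K (2 ^ (2 * K)) := by
  rcases Nat.eq_zero_or_pos K with hK | hK
  · subst hK; exact realRootLawAt_zero m _
  refine Census.realRootLawAt_mono ?_ (Census.realRootLawAt_descartes m K hK)
  have h1 : Nat.choose (m + K - 1) m ≤ 2 ^ (m + K - 1) := Nat.choose_le_two_pow _ _
  have h2 : 2 ^ (m + K - 1) ≤ 2 ^ (2 * K - 1) := Nat.pow_le_pow_right (by norm_num) (by omega)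
  have h3 : 2 * 2 ^ (2 * K - 1) = 2 ^ (2 * K) := by
    rw [← pow_succ']; congr 1; omega
  omega

/-- **LIFT at the fat end `m ≤ K` (C = 3), with no tropical input.** -/
theorem lifting_rung_fatEnd (m K B : ℕ) (hmK : m ≤ K) (_h : TropRow m K B) :
    RealRootLawAt m K (2 ^ (3 * K) * (B + 1)) := by
  refine Census.realRootLawAt_mono ?_ (realRootLawAt_fatEnd hmK)
  calc 2 ^ (2 * K) ≤ 2 ^ (3 * K) := Nat.pow_le_pow_right (by norm_num) (by omega)
    _ ≤ 2 ^ (3 * K) * (B + 1) := Nat.le_mul_of_pos_right _ (Nat.succ_pos B)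


/-- **fat-end rung of `Lifting`** (theorem, Descartes-vacuous): for `m ≤ K`, `RealRootLawAt m K (2^(3K) (n+1))`. -/
theorem Lifting_rung_fatEnd (m K n : ℕ) (hmK : m ≤ K) (h : TropRow m K n) :
    RealRootLawAt m K (2 ^ (3 * K) * (n + 1)) :=
  lifting_rung_fatEnd m K n hmK h

end Summit.ValiantsHypothesis.ValiantsHypothesis.Theses.KPlusLogSqLaw
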